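/-
Copyright (c) 2026 the pub-hodgecm-mathlib formalisation cell (harness21).  Prover seat hodgecm-mathlib-K2Liu-p05 (g5), Track B «K2-LIT»,
#184♮ = hLiu418 = `stmt-HodgeConjecture-24832`; #42S payer road, organ S2 (archimedean spanning), file S2-J part J2d (Hermite vectors)
(LEAD F0P6-plan (g14) BATCH #20 (1) «(V-inst) = p05 after J2c»; sequel of ★ J2c `K2LiuArchWeilJunctionTransport`).
-/
import Summits.HodgeConjecture.HodgeConjecture.Theorems.K2LiuArchWeilJunctionTransport     -- ★ J2c `exists_clm_swSectionTensor_mul_oneplace_eq`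
import Literature.NumberTheory.GelbartRogawski1991.DoubledWeilRepresentationArchVacuum      -- ★ `GRConstruction.frameD`, `follandHermite`
import Literature.RepresentationTheory.KonnoKonno2007.JunctionHyperbolicReindex            -- ★ `schwartzTransport_reindexCLE(_symm)_hermitePi`
import Literature.Analysis.SegalBargmann.SchwartzTensorPi                                   -- ★ `hermitePi_sumIdx`
import HarnessLib

/-!
# Crux `HLiu418`, #42S organ S2, file S2-J part J2d: THE HERMITE VECTORS OF THE BIG FRAME ARE PLACE-PURE TENSORS, AND THE ONE-PLACE LAW ON THEM —
# `𝒥 (follandHermite frameD β) = (e_* h_{β₁}) ⊠ h_{β₂}`, hence `f_{h_β ⊗ f}(H · k_h) = η · ℓ′((e_* ω(h,1) h_{β₁}) ⊠ h_{β₂})`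

Cell `hodgecm-mathlib`, crux item hLiu418 = `stmt-HodgeConjecture-24832`; squad K2 ∕ K2Liu; LEAD F0P6-plan (g14); prover K2Liu-p05 (g5).
THEOREMS ONLY (no `def`, no instance, no notation, no named-fact hypothesis, no `sorry`); lane `--supports stmt-HodgeConjecture-24832 --as helper`.

WHY.  ★ J2c reads the Siegel–Weil section of `𝔻 ⊗ V′` along a one-place subgroup of the small group through the junction Weil representation of the pair, on
test vectors `a` whose junction-frame image `𝒥 a` is a product `(e_* Φ₁) ⊠ Φ₂`.  The realisers of the arch organ (σ15: `𝒫_{≤d}·Gauss`, ★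
`K2LiuWeilDatumFockStabilityU22`) and the product∕place assembly (S2-⊗ (V-gen) ★ `K2LiuPureTensorFactorwiseFunctional`, binder (T)) live on the HERMITE FUNCTIONS
`follandHermite frameD β` of the big scaled Folland frame (★ `DoubledWeilRepresentationArchVacuum`: the doubled Gaussian is `β = 0`).  This file proves that
those ARE place-pure tensors in the junction frame and reads J2c on them:
* **`frame_follandHermite_eq_tensorPi_hermitePi`** — for every pair of multi-indices `β₁` on the place-`σ` junction block `DPIdx P Q R S` and `β₂` on the other
  places there is `β` with `𝒥 (follandHermite frameD β) = (e_* h_{β₁}) ⊠ h_{β₂}` (★ `schwartzTransport_follandHermite`, ★ `schwartzTransport_reindexCLE_hermitePi`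
  three times, ★ `hermitePi_sumIdx`);
* **`exists_clm_swSectionTensor_follandHermite_oneplace_eq`** — J2c ON HERMITE VECTORS: one continuous linear `ℓ′` with, for all `h`, `β₁`, `β₂` and the `β` above,
  `swSectionTensor sB (E(follandHermite frameD β ⊗ f)) (H · archEmb (ψ h)) = η_t(…) · ℓ′ ((e_* (ω_{(P,Q),(R,S)} (h,1) h_{β₁})) ⊠ h_{β₂})` — the per-place input (T)
  of (V-inst) at the vector `h_β`, under the (J2⊗-arch) identity `hsec` (K2E5-p16) as in J2c.
References: [Folland1989] §1.7 (1.81), Prop. (1.43), §4.2 (4.23); [KonnoKonno2007] §3.3 p. 47, Lemma 5.2; [Weil1964] Chap. I n° 12, Chap. III n° 37–39;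
[KudlaRallis1994] §1.
HONEST LABEL.  Count-neutral helper: `HC_CM` is proved only modulo the 7 printed citations (2 remaining named inputs: hLiu418 = `stmt-HodgeConjecture-24832`,
h413 = `stmt-HodgeConjecture-24833`) until rung 0 closes.
-/

set_option autoImplicit false
set_option linter.dupNamespace false -- the mandated namespace repeats `HodgeConjecture.HodgeConjecture`
set_option synthInstance.maxSize 512 -- `DecidableEq` of the nested block index (as ★ `K2LiuWeilSeesawRelabel`)

noncomputable section

open scoped Classical Matrix TensorProduct Kronecker SchwartzMap
open NumberField NumberField.InfinitePlace NumberField.mixedEmbedding IsDedekindDomain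
open Literature.Analysis.SegalBargmann Literature.RepresentationTheory.HeisenbergGroup
open Literature.NumberTheory.Automorphic Literature.NumberTheory.Automorphic.UnitaryGroup Literature.NumberTheory.GaloisRepresentations
open Literature.NumberTheory.Weil1964 Literature.NumberTheory.Weil1964.MpS Literature.NumberTheory.Weil1964.UnitaryWeil
open Literature.RepresentationTheory.HarrisKudlaSweet1996
open Literature.RepresentationTheory.KonnoKonno2007 Literature.RepresentationTheory.KonnoKonno2007.RealDualPair
open Literature.NumberTheory.GelbartRogawski1991 Literature.NumberTheory.GelbartRogawski1991.GRConstruction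
open Literature.NumberTheory.GelbartRogawski1991.UnitaryDualPair
open Literature.NumberTheory.GelbartRogawski1991.UnitaryDualPair.LocalSplitting
open Literature.NumberTheory.K2Lit.SiegelDoubled
open Summit.HodgeConjecture.HodgeConjecture.Cruxes.HLiu418.K2LiuArchSectionPlaceBlock
open Summit.HodgeConjecture.HodgeConjecture.Cruxes.HLiu418 (K2LiuArchOneParameterOrbitDefs.archEmb)
open Summit.HodgeConjecture.HodgeConjecture.Cruxes.HLiu418.K2LiuSwSectionArchOrbit
open Summit.HodgeConjecture.HodgeConjecture.Cruxes.HLiu418.K2LiuWeilSeesawRelabel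
open Summit.HodgeConjecture.HodgeConjecture.Cruxes.HLiu418.K2LiuArchWeilJunctionTransport

namespace Summit.HodgeConjecture.HodgeConjecture.Cruxes.HLiu418.K2LiuArchWeilJunctionHermite

variable (L : Type) [Field L] [NumberField L] [IsCMField L]
variable {N M n : ℕ} (e : Fin N × Fin M ≃ Fin n)
  (dV : Fin N → L) (hdV : ∀ i, IsCMField.complexConj L (dV i) = dV i) (hdV0 : ∀ i, dV i ≠ 0)
  (dW : Fin M → L) (hdW : ∀ i, IsCMField.complexConj L (dW i) = dW i) (hdW0 : ∀ i, dW i ≠ 0)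
variable {M₂ M' n' : ℕ} (eW : Fin M × Fin M₂ ≃ Fin M') (e' : Fin N × Fin M' ≃ Fin n')
  (dV' : Fin M₂ → L) (hdV' : ∀ k, IsCMField.complexConj L (dV' k) = dV' k) (hdV'0 : ∀ k, dV' k ≠ 0)
variable (σ : {v : InfinitePlace (Fp L) // v.IsReal})
  {P Q R S : Type} [Fintype P] [DecidableEq P] [Fintype Q] [DecidableEq Q] [Fintype R] [DecidableEq R] [Fintype S] [DecidableEq S]
  (eP : PosIdx (signVec (cmPlaceOver L) (fun k => Sum.elim (cmGramEntry L e' dV hdV (tensorFrame L dW eW dV') (tensorFrame_real L dW hdW eW dV' hdV')) (-cmGramEntry L e' dV hdV (tensorFrame L dW eW dV') (tensorFrame_real L dW hdW eW dV' hdV')) ((LocalSplitting.e₂ n').symm k)) (imagUnit L) σ) ≃ (P × R) ⊕ (Q × S))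
  (eQ : NegIdx (signVec (cmPlaceOver L) (fun k => Sum.elim (cmGramEntry L e' dV hdV (tensorFrame L dW eW dV') (tensorFrame_real L dW hdW eW dV' hdV')) (-cmGramEntry L e' dV hdV (tensorFrame L dW eW dV') (tensorFrame_real L dW hdW eW dV' hdV')) ((LocalSplitting.e₂ n').symm k)) (imagUnit L) σ) ≃ (P × S) ⊕ (Q × R))

-- the doubled metaplectic carrier of the big datum and the CM sign frame elaborate slowly (as ★ J2c)
set_option maxHeartbeats 4000000

/-- **THE HERMITE FUNCTIONS OF THE BIG FRAME ARE PLACE-PURE TENSORS IN THE JUNCTION FRAME**: for every `β₁` on the place-`σ` block `DPIdx P Q R S` and every `β₂` on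
the remaining places there is a multi-index `β` of the big frame with `𝒥 (follandHermite frameD β) = (e_* h_{β₁}) ⊠ h_{β₂}` — `𝒥` unwinds `frameD` (★
`schwartzTransport_follandHermite`) and relabels `h_β` three times (★ `schwartzTransport_reindexCLE_hermitePi`), and `h_{(γ₁,γ₂)} = h_{γ₁} ⊠ h_{γ₂}` (★ `hermitePi_sumIdx`).
[cite: Folland1989, §1.7 (1.81)] [cite: Weil1964, Chap. I n° 12 p. 160] -/
theorem frame_follandHermite_eq_tensorPi_hermitePi (β₁ : DPIdx P Q R S →₀ ℕ) (β₂ : (Fin (n' + n') × {v : {v : InfinitePlace (Fp L) // v.IsReal} // v ≠ σ}) →₀ ℕ) :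
    ∃ β : (Fin (n' + n') × {v : InfinitePlace (Fp L) // v.IsReal}) →₀ ℕ,
      ((((schwartzTransport
                  (scaledFrame (Fp L) (Fin (n' + n'))
                    (placeScale (n' + n') fun v => sqrtAbs (signVec (cmPlaceOver L)
                      (fun k => Sum.elim (cmGramEntry L e' dV hdV (tensorFrame L dW eW dV') (tensorFrame_real L dW hdW eW dV' hdV')) (-cmGramEntry L e' dV hdV (tensorFrame L dW eW dV') (tensorFrame_real L dW hdW eW dV' hdV')) ((LocalSplitting.e₂ n').symm k))
                      (imagUnit L) v))
                    (placeScale_ne_zero (n' + n') (sqrtAbs_signVec_ne_zero (IsCMField.complexConj_ne_one L) (cmPlaceOver_smul L)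
                      (complexConj_imagUnit L) (imagUnit_ne_zero L) (gramD_gram_realDiagonal_entry_ne_zero L e' dV hdV (tensorFrame L dW eW dV') (tensorFrame_real L dW hdW eW dV' hdV') hdV0 (tensorFrame_ne_zero L dW eW dV' hdW0 hdV'0)))))).trans
                (schwartzTransport (reindexCLE (placeSplitEquiv (signSplit (signVec (cmPlaceOver L)
                  (fun k => Sum.elim (cmGramEntry L e' dV hdV (tensorFrame L dW eW dV') (tensorFrame_real L dW hdW eW dV' hdV')) (-cmGramEntry L e' dV hdV (tensorFrame L dW eW dV') (tensorFrame_real L dW hdW eW dV' hdV')) ((LocalSplitting.e₂ n').symm k))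
                  (imagUnit L) σ)) σ)))).trans
                (schwartzTransport (reindexCLE (Equiv.sumCongr
                  (unitJunctionIdx
                    (PosIdx (signVec (cmPlaceOver L)
                      (fun k => Sum.elim (cmGramEntry L e' dV hdV (tensorFrame L dW eW dV') (tensorFrame_real L dW hdW eW dV' hdV')) (-cmGramEntry L e' dV hdV (tensorFrame L dW eW dV') (tensorFrame_real L dW hdW eW dV' hdV')) ((LocalSplitting.e₂ n').symm k))
                      (imagUnit L) σ))
                    (NegIdx (signVec (cmPlaceOver L)
                      (fun k => Sum.elim (cmGramEntry L e' dV hdV (tensorFrame L dW eW dV') (tensorFrame_real L dW hdW eW dV' hdV')) (-cmGramEntry L e' dV hdV (tensorFrame L dW eW dV') (tensorFrame_real L dW hdW eW dV' hdV')) ((LocalSplitting.e₂ n').symm k))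
                      (imagUnit L) σ))).symm
                  (Equiv.refl (Fin (n' + n') × {v : {v : InfinitePlace (Fp L) // v.IsReal} // v ≠ σ})))))).trans
                (schwartzTransport (reindexCLE (Equiv.sumCongr
                  (dpIdxCongr
                    (PosIdx (signVec (cmPlaceOver L)
                      (fun k => Sum.elim (cmGramEntry L e' dV hdV (tensorFrame L dW eW dV') (tensorFrame_real L dW hdW eW dV' hdV')) (-cmGramEntry L e' dV hdV (tensorFrame L dW eW dV') (tensorFrame_real L dW hdW eW dV' hdV')) ((LocalSplitting.e₂ n').symm k))
                      (imagUnit L) σ))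
                    (NegIdx (signVec (cmPlaceOver L)
                      (fun k => Sum.elim (cmGramEntry L e' dV hdV (tensorFrame L dW eW dV') (tensorFrame_real L dW hdW eW dV' hdV')) (-cmGramEntry L e' dV hdV (tensorFrame L dW eW dV') (tensorFrame_real L dW hdW eW dV' hdV')) ((LocalSplitting.e₂ n').symm k))
                      (imagUnit L) σ))
                    Unit Empty ((P × R) ⊕ (Q × S)) ((P × S) ⊕ (Q × R)) Unit Empty eP eQ (Equiv.refl Unit) (Equiv.refl Empty)).symm
                  (Equiv.refl (Fin (n' + n') × {v : {v : InfinitePlace (Fp L) // v.IsReal} // v ≠ σ})))))) (follandHermite (GRConstruction.frameD L e' dV hdV hdV0 (tensorFrame L dW eW dV') (tensorFrame_real L dW hdW eW dV' hdV') (tensorFrame_ne_zero L dW eW dV' hdW0 hdV'0)) β) =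
        tensorPi ((schwartzTransport (reindexCLE (unitJunctionIdx ((P × R) ⊕ (Q × S)) ((P × S) ⊕ (Q × R))).symm)) (hermitePi β₁)) (hermitePi β₂) := by
  -- read the target backwards through the three relabellings: it is `h_γ` for an explicit `γ`, and `𝒥 (follandHermite frameD γ′) = h_γ` for `γ′ = γ` relabelled
  rw [schwartzTransport_reindexCLE_hermitePi, ← hermitePi_sumIdx]
  refine ⟨(((sumIdx (β₁.equivMapDomain (unitJunctionIdx ((P × R) ⊕ (Q × S)) ((P × S) ⊕ (Q × R))).symm.symm) β₂).equivMapDomain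
      (Equiv.sumCongr
        (dpIdxCongr (PosIdx (signVec (cmPlaceOver L) (fun k => Sum.elim (cmGramEntry L e' dV hdV (tensorFrame L dW eW dV') (tensorFrame_real L dW hdW eW dV' hdV')) (-cmGramEntry L e' dV hdV (tensorFrame L dW eW dV') (tensorFrame_real L dW hdW eW dV' hdV')) ((LocalSplitting.e₂ n').symm k)) (imagUnit L) σ)) (NegIdx (signVec (cmPlaceOver L) (fun k => Sum.elim (cmGramEntry L e' dV hdV (tensorFrame L dW eW dV') (tensorFrame_real L dW hdW eW dV' hdV')) (-cmGramEntry L e' dV hdV (tensorFrame L dW eW dV') (tensorFrame_real L dW hdW eW dV' hdV')) ((LocalSplitting.e₂ n').symm k)) (imagUnit L) σ)) Unit Empty ((P × R) ⊕ (Q × S)) ((P × S) ⊕ (Q × R)) Unit Empty eP eQ (Equiv.refl Unit)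
          (Equiv.refl Empty)).symm
        (Equiv.refl (Fin (n' + n') × {v : {v : InfinitePlace (Fp L) // v.IsReal} // v ≠ σ}))).symm.symm).equivMapDomain
      (Equiv.sumCongr (unitJunctionIdx (PosIdx (signVec (cmPlaceOver L) (fun k => Sum.elim (cmGramEntry L e' dV hdV (tensorFrame L dW eW dV') (tensorFrame_real L dW hdW eW dV' hdV')) (-cmGramEntry L e' dV hdV (tensorFrame L dW eW dV') (tensorFrame_real L dW hdW eW dV' hdV')) ((LocalSplitting.e₂ n').symm k)) (imagUnit L) σ)) (NegIdx (signVec (cmPlaceOver L) (fun k => Sum.elim (cmGramEntry L e' dV hdV (tensorFrame L dW eW dV') (tensorFrame_real L dW hdW eW dV' hdV')) (-cmGramEntry L e' dV hdV (tensorFrame L dW eW dV') (tensorFrame_real L dW hdW eW dV' hdV')) ((LocalSplitting.e₂ n').symm k)) (imagUnit L) σ))).symm (Equiv.refl (Fin (n' + n') × {v : {v : InfinitePlace (Fp L) // v.IsReal} // v ≠ σ}))).symm.symm).equivMapDomain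
      (placeSplitEquiv (signSplit (signVec (cmPlaceOver L) (fun k => Sum.elim (cmGramEntry L e' dV hdV (tensorFrame L dW eW dV') (tensorFrame_real L dW hdW eW dV' hdV')) (-cmGramEntry L e' dV hdV (tensorFrame L dW eW dV') (tensorFrame_real L dW hdW eW dV' hdV')) ((LocalSplitting.e₂ n').symm k)) (imagUnit L) σ)) σ).symm.symm, ?_⟩
  simp only [ContinuousLinearEquiv.trans_apply, schwartzTransport_follandHermite, schwartzTransport_reindexCLE_hermitePi,
    ← Finsupp.equivMapDomain_trans, Equiv.symm_symm, Equiv.self_trans_symm, Equiv.trans_assoc]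
  congr 1
  ext k
  simp only [Finsupp.equivMapDomain_apply, Equiv.symm_trans_apply, Equiv.symm_symm, Equiv.symm_apply_apply, Equiv.coe_refl, id_eq,
    Equiv.refl_symm]

include hdW0 in
/-- **J2c ON HERMITE VECTORS.**  Under the hypotheses of ★ `exists_clm_swSectionTensor_mul_oneplace_eq` (a `χ`-normalised `sB` on `𝔻 ⊗ V′`, `f`, `H`, a one-place
homomorphism `ψ` of the small group with the (J2⊗-arch) identity `hsec`): ONE continuous linear `ℓ′` such that for all multi-indices `β₁` (place-`σ` junction block of the
PAIR) and `β₂` (other places) there is a big-frame multi-index `β` (the one of `frame_follandHermite_eq_tensorPi_hermitePi`, free of `h`) with, for every `h ∈ U(P,Q)`: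
`swSectionTensor sB (E(follandHermite frameD β ⊗ f)) (H · archEmb (ψ h)) = η_t(…) · ℓ′ ((e_* (ω_{(P,Q),(R,S)} (h,1) h_{β₁})) ⊠ h_{β₂})` — the factorwise binder (T) of ★
`K2LiuPureTensorFactorwiseFunctional` at the place `σ` on the Hermite basis, up to the character `η_t` and the functional `ℓ′`.
[cite: KonnoKonno2007, §3.3 p. 47, Lemma 5.2] [cite: Folland1989, Prop. (1.43), §1.7 (1.81)] [cite: KudlaRallis1994, §1] -/
theorem exists_clm_swSectionTensor_follandHermite_oneplace_eq {χ : HeckeCharacter L} (hχu : χ.IsUnitary) (hχs : IsSplittingChar L 1 χ)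
    {sB : HA L e' dV hdV (tensorFrame L dW eW dV') (tensorFrame_real L dW hdW eW dV' hdV') →*
      MpD L e' dV hdV (tensorFrame L dW eW dV') (tensorFrame_real L dW hdW eW dV' hdV')}
    (hsB : IsDoubledWeilRep L e' dV hdV hdV0 (tensorFrame L dW eW dV') (tensorFrame_real L dW hdW eW dV' hdV')
      (tensorFrame_ne_zero L dW eW dV' hdW0 hdV'0) χ sB)
    {t : InfinitePlace L → ℤ} (ht : χ.HasUnitaryArchType t 0) (hodd : ∀ w, Odd (t w))
    (H : HA L e dV hdV dW hdW) (f : FinSB (Fp L) (Fin (n' + n')))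
    (ψ : UForm P Q →* UnitaryGroup.arch (Fp L) L (IsCMField.complexConj L) (n + n) (hermD L e dV hdV dW hdW))
    (hsec : ∀ h : UForm P Q,
      tensorEmb L e dV hdV dW hdW eW e' dV' hdV' (K2LiuArchOneParameterOrbitDefs.archEmb (Fp L) L (IsCMField.complexConj L) (n + n) (hermD L e dV hdV dW hdW) (ψ h)) =
        K2LiuArchOneParameterOrbitDefs.archEmb (Fp L) L (IsCMField.complexConj L) (n' + n') (hermD L e' dV hdV (tensorFrame L dW eW dV') (tensorFrame_real L dW hdW eW dV' hdV'))
          (placeSecJ L (IsCMField.complexConj L) (n' + n') (IsCMField.complexConj_ne_one L) (cmPlaceOver L) (cmPlaceOver_smul L) _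
                (gramD_gram_realDiagonal_entry_ne_zero L e' dV hdV (tensorFrame L dW eW dV') (tensorFrame_real L dW hdW eW dV' hdV') hdV0 (tensorFrame_ne_zero L dW eW dV' hdW0 hdV'0)) (complexConj_imagUnit L) (imagUnit_ne_zero L) σ
                (cmPlaceOver_comap L) (gramD_eq_diagonal_cm L e' dV hdV (tensorFrame L dW eW dV') (tensorFrame_real L dW hdW eW dV' hdV')) (J := hermD L e' dV hdV (tensorFrame L dW eW dV') (tensorFrame_real L dW hdW eW dV' hdV')) rfl
                (complexConj_smul_infinitePlace L) eP eQ ((toBig P Q R S (h, 1), (1 : UForm Unit Empty)) : Ginf ((P × R) ⊕ (Q × S)) ((P × S) ⊕ (Q × R)) Unit Empty))) :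
    ∃ ℓ' : 𝓢(((DPIdx ((P × R) ⊕ (Q × S)) ((P × S) ⊕ (Q × R)) Unit Empty ⊕ (Fin (n' + n') × {v : {v : InfinitePlace (Fp L) // v.IsReal} // v ≠ σ})) → ℝ), ℂ) →L[ℂ] ℂ,
      ∀ (β₁ : DPIdx P Q R S →₀ ℕ) (β₂ : (Fin (n' + n') × {v : {v : InfinitePlace (Fp L) // v.IsReal} // v ≠ σ}) →₀ ℕ),
        ∃ β : (Fin (n' + n') × {v : InfinitePlace (Fp L) // v.IsReal}) →₀ ℕ, ∀ h : UForm P Q,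
          swSectionTensor L e dV hdV dW hdW eW e' dV' hdV' hdV0 hdW0 hdV'0 sB (piSchwartzBruhatEquiv (Fp L) (Fin (n' + n')) (follandHermite (GRConstruction.frameD L e' dV hdV hdV0 (tensorFrame L dW eW dV') (tensorFrame_real L dW hdW eW dV' hdV') (tensorFrame_ne_zero L dW eW dV' hdW0 hdV'0)) β ⊗ₜ f))
            (H * K2LiuArchOneParameterOrbitDefs.archEmb (Fp L) L (IsCMField.complexConj L) (n + n) (hermD L e dV hdV dW hdW) (ψ h)) =
            (((etaD L e' dV hdV (tensorFrame L dW eW dV') (tensorFrame_real L dW hdW eW dV' hdV') t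
              (placeSecJ L (IsCMField.complexConj L) (n' + n') (IsCMField.complexConj_ne_one L) (cmPlaceOver L) (cmPlaceOver_smul L) _
                (gramD_gram_realDiagonal_entry_ne_zero L e' dV hdV (tensorFrame L dW eW dV') (tensorFrame_real L dW hdW eW dV' hdV') hdV0 (tensorFrame_ne_zero L dW eW dV' hdW0 hdV'0)) (complexConj_imagUnit L) (imagUnit_ne_zero L) σ
                (cmPlaceOver_comap L) (gramD_eq_diagonal_cm L e' dV hdV (tensorFrame L dW eW dV') (tensorFrame_real L dW hdW eW dV' hdV')) (J := hermD L e' dV hdV (tensorFrame L dW eW dV') (tensorFrame_real L dW hdW eW dV' hdV')) rfl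
                (complexConj_smul_infinitePlace L) eP eQ ((toBig P Q R S (h, 1), (1 : UForm Unit Empty)) : Ginf ((P × R) ⊕ (Q × S)) ((P × S) ⊕ (Q × R)) Unit Empty)) : ℂˣ) : ℂ)) *
              ℓ' (tensorPi ((schwartzTransport (reindexCLE (unitJunctionIdx ((P × R) ⊕ (Q × S)) ((P × S) ⊕ (Q × R))).symm))
                ((weilRep (α := (P × R) ⊕ (Q × S)) (β := (P × S) ⊕ (Q × R))).comp (toBig P Q R S) ((h, (1 : UForm R S)) : Ginf P Q R S) (hermitePi β₁)))
                (hermitePi β₂)) := by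
  obtain ⟨ℓ', hℓ'⟩ := exists_clm_swSectionTensor_mul_oneplace_eq L e dV hdV hdV0 dW hdW hdW0 eW e' dV' hdV' hdV'0 σ eP eQ hχu hχs hsB ht hodd H f ψ hsec
  refine ⟨ℓ', fun β₁ β₂ => ?_⟩
  obtain ⟨β, hβ⟩ := frame_follandHermite_eq_tensorPi_hermitePi L dV hdV hdV0 dW hdW hdW0 eW e' dV' hdV' hdV'0 σ eP eQ β₁ β₂
  exact ⟨β, fun h => hℓ' h (hermitePi β₁) (hermitePi β₂) _ hβ⟩

end Summit.HodgeConjecture.HodgeConjecture.Cruxes.HLiu418.K2LiuArchWeilJunctionHermite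

end
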